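import Mathlib
import Summits.Ventures.HodgeRepro2.T5LocalFieldUnitsDecomposition

/-! # T5InertForcing — the three «forcing facts» E9 of N4.1 (P7, F1–F3) in kernel form

Blind cell pub-hodge-repro2, seat p4 (Tier-5 kernel annex, README §7; record-class, cited by p-id
or ignored, never an input). README §8(d): uses an L-value-free non-vanishing device: NO.

The owner's row (route/T5-N4.1-route-1.md §N4.1.4, E9, status «elementary (valuation of z z̄ =
2 ord z; E_v^× = ϖ_v^ℤ × O_{E_v}^×)»): «the three forcing facts at an inert unramified place (P7
F1–F3): E¹_v is compact and equals its own maximal compact subgroup (norm-1 elements are units);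
an unramified character of E_v^× trivial on F_v^× is trivial (ϖ_v ∈ F_v); an unramified character
with restriction ε_{E_v/F_v} to F_v^× is the unramified quadratic character ε′_v».

Kernel content — `L = E_v` is the fraction field of a discrete valuation ring `S = O_{E_v}` with
uniformiser `ϖ` (the inert place: `ϖ = ϖ_v ∈ F_v`); «unramified» = trivial on the image of `Sˣ`;
characters take values in any commutative group `M` (`ℂˣ`, `Circle`); the decomposition
`Lˣ = image (Sˣ) ⊔ ⟨ϖ⟩` is `T5LocalFieldUnitsDecomposition.unitsRange_sup_zpowers_eq_top`
(p392548):
* (F1) `val_eq_one_of_mul_eq_one_of_val_eq` / `val_eq_one_of_mul_conj_eq_one` : `z * σ z = 1`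
  with `v ∘ σ = v` forces `v z = 1` («`v(z z̄) = 2 ord z`»), and `exists_unit_of_mul_conj_eq_one` :
  such a `z` is (the image of) a unit of the valuation ring («norm-1 elements are units»);
  the compactness of `E¹_v` itself stays prose;
* `eq_zero_of_zpow_mem_unitsRange` / `disjoint_unitsRange_zpowers` : `⟨ϖ⟩ ∩ image (Sˣ) = 1`, so
  with p392548 `Lˣ = image (Sˣ) × ϖ^ℤ` («`E_v^× = ϖ_v^ℤ × O_{E_v}^×`»);
* (F2) `eq_one_of_unramified_of_le_ker` : an unramified character of `Lˣ` trivial on a subgroup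
  containing `ϖ` (= `F_v^× ∋ ϖ_v`) is trivial;
* (F3) `eq_of_unramified_of_apply_uniformizer_eq` : two unramified characters of `Lˣ` that agree
  at `ϖ` are equal — applied to `χ` and to the unramified quadratic character `ε′_v` (both unramified,
  both `= ε_{E_v/F_v}(ϖ_v) = −1` at `ϖ_v`), this is «`χ = ε′_v`»;
* the group-theoretic cores `eq_one_of_sup_zpowers_eq_top` / `eq_of_sup_zpowers_eq_top` for any
  commutative group `G = H ⊔ ⟨g⟩`.

Stays prose: that `E_v` is the fraction field of the discrete valuation ring `O_{E_v}` with `ϖ_v`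
a uniformiser at an inert place, that `F_v^×` is the named subgroup of `E_v^×`, the values
`ε_{E_v/F_v}(ϖ_v) = ε′_v(ϖ_v) = −1`, the valuation-invariance of the conjugation `σ`, and the
compactness of `E¹_v`.
-/

namespace Summit.Ventures.HodgeRepro2.T5InertForcing

open Summit.Ventures.HodgeRepro2.T5LocalFieldUnitsDecomposition
open scoped WithZero

section Group

variable {G M : Type*} [CommGroup G] [CommGroup M]

/-- If `G = H ⊔ ⟨g⟩` and the homomorphism `χ` is trivial on `H` and at `g`, then `χ = 1`. -/
theorem eq_one_of_sup_zpowers_eq_top (H : Subgroup G) (g : G) (hG : H ⊔ Subgroup.zpowers g = ⊤)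
    (χ : G →* M) (hH : H ≤ χ.ker) (hg : χ g = 1) : χ = 1 := by
  ext x
  obtain ⟨h, hh, k, hk, rfl⟩ := Subgroup.mem_sup.1 (hG ▸ Subgroup.mem_top x)
  obtain ⟨n, rfl⟩ := Subgroup.mem_zpowers_iff.1 hk
  rw [map_mul, map_zpow, MonoidHom.mem_ker.1 (hH hh), hg, one_zpow, one_mul, MonoidHom.one_apply]

/-- If `G = H ⊔ ⟨g⟩` and two homomorphisms `χ, χ'` are trivial on `H` and agree at `g`, they are
equal. -/
theorem eq_of_sup_zpowers_eq_top (H : Subgroup G) (g : G) (hG : H ⊔ Subgroup.zpowers g = ⊤)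
    (χ χ' : G →* M) (hH : H ≤ χ.ker) (hH' : H ≤ χ'.ker) (hg : χ g = χ' g) : χ = χ' := by
  ext x
  obtain ⟨h, hh, k, hk, rfl⟩ := Subgroup.mem_sup.1 (hG ▸ Subgroup.mem_top x)
  obtain ⟨n, rfl⟩ := Subgroup.mem_zpowers_iff.1 hk
  rw [map_mul, map_mul, map_zpow, map_zpow, hg, MonoidHom.mem_ker.1 (hH hh),
    MonoidHom.mem_ker.1 (hH' hh)]

end Group

section NormOne

variable {K : Type*} [Field K] (v : Valuation K ℤᵐ⁰)

/-- (F1), the valuation identity: if `z * w = 1` and `v w = v z` (e.g. `w = σ z` for a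
valuation-preserving automorphism `σ`), then `v z = 1` — «`v(z z̄) = 2 ord z`, so `ord z = 0`». -/
theorem val_eq_one_of_mul_eq_one_of_val_eq {z w : K} (h : z * w = 1) (hw : v w = v z) :
    v z = 1 := by
  have hz : v z ≠ 0 := by
    intro h0
    have h1 : v (z * w) = 0 := by rw [map_mul, h0, zero_mul]
    rw [h, map_one] at h1
    exact one_ne_zero h1
  have h2 : v z * v z = 1 := by
    calc v z * v z = v z * v w := by rw [hw]
      _ = v (z * w) := (map_mul v z w).symm
      _ = 1 := by rw [h, map_one]
  have hl := congrArg WithZero.log h2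
  rw [WithZero.log_mul hz hz, WithZero.log_one] at hl
  have hl0 : WithZero.log (v z) = 0 := by linarith
  rw [← WithZero.exp_log hz, hl0, WithZero.exp_zero]

/-- (F1) for a conjugation `σ` preserving the valuation: `z * σ z = 1` forces `v z = 1`. -/
theorem val_eq_one_of_mul_conj_eq_one (σ : K →+* K) (hσ : ∀ x, v (σ x) = v x) {z : K}
    (h : z * σ z = 1) : v z = 1 :=
  val_eq_one_of_mul_eq_one_of_val_eq v h (hσ z)

/-- (F1), «norm-1 elements are units»: for the valuation ring `O` of `v` (`Valuation.Integers v O`)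
and `z * σ z = 1` with `σ` valuation-preserving, `z` is the image of a unit of `O`. -/
theorem exists_unit_of_mul_conj_eq_one {O : Type*} [CommRing O] [Algebra O K]
    (hv : Valuation.Integers v O) (σ : K →+* K) (hσ : ∀ x, v (σ x) = v x) {z : K}
    (h : z * σ z = 1) : ∃ u : Oˣ, algebraMap O K u = z := by
  have h1 : v z = 1 := val_eq_one_of_mul_conj_eq_one v σ hσ h
  obtain ⟨x, hx⟩ := hv.exists_of_le_one h1.le
  have hu : IsUnit x := hv.isUnit_of_one' (by rw [hx, h1])
  exact ⟨hu.unit, by rw [IsUnit.unit_spec, hx]⟩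

end NormOne

section DVR

variable {S L : Type*} [CommRing S] [IsDomain S] [IsDiscreteValuationRing S] [Field L]
  [Algebra S L] [IsFractionRing S L] {M : Type*} [CommGroup M]

omit [IsDiscreteValuationRing S] in
/-- A power `ϖ ^ k` of the uniformiser lies in the image of `Sˣ` only for `k = 0`
(`ϖ` is not a unit of `S`, `isUnit_pow_iff`). -/
theorem eq_zero_of_zpow_mem_unitsRange (ϖ : S) (hϖ : Irreducible ϖ) (k : ℤ)
    (hk : uniformizerUnit ϖ hϖ ^ k ∈ (Units.map (algebraMap S L : S →* L)).range) : k = 0 := by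
  obtain ⟨u, hu⟩ := hk
  have hval : algebraMap S L (u : S) = algebraMap S L ϖ ^ k := by
    have := congrArg Units.val hu
    rw [Units.coe_map, Units.val_zpow_eq_zpow_val] at this
    exact this
  have hinj := IsFractionRing.injective S L
  by_contra hk0
  rcases Int.natAbs_eq k with hpos | hneg
  · -- k = n ≥ 1
    have hn : k.natAbs ≠ 0 := Int.natAbs_ne_zero.2 hk0
    rw [hpos, zpow_natCast, ← map_pow] at hval
    have hpow : IsUnit (ϖ ^ k.natAbs) := by
      rw [← hinj hval]; exact u.isUnit
    exact hϖ.not_isUnit ((isUnit_pow_iff hn).1 hpow)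
  · -- k = -n, n ≥ 1
    have hn : k.natAbs ≠ 0 := Int.natAbs_ne_zero.2 hk0
    rw [hneg, zpow_neg, zpow_natCast, ← map_pow] at hval
    have hmul : algebraMap S L ((u : S) * ϖ ^ k.natAbs) = algebraMap S L 1 := by
      rw [map_mul, hval, map_one, inv_mul_cancel₀]
      exact fun h0 =>
        pow_ne_zero _ hϖ.ne_zero ((IsFractionRing.to_map_eq_zero_iff (K := L)).1 h0)
    have hpow : IsUnit (ϖ ^ k.natAbs) :=
      IsUnit.of_mul_eq_one (u : S) (by rw [mul_comm]; exact hinj hmul)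
    exact hϖ.not_isUnit ((isUnit_pow_iff hn).1 hpow)

omit [IsDiscreteValuationRing S] in
/-- `⟨ϖ⟩ ∩ image (Sˣ) = 1`: together with `unitsRange_sup_zpowers_eq_top` (p392548),
`Lˣ = image (Sˣ) × ϖ^ℤ` — «`E_v^× = ϖ_v^ℤ × O_{E_v}^×`». -/
theorem disjoint_unitsRange_zpowers (ϖ : S) (hϖ : Irreducible ϖ) :
    Disjoint (Units.map (algebraMap S L : S →* L)).range
      (Subgroup.zpowers (uniformizerUnit ϖ hϖ)) := by
  rw [Subgroup.disjoint_def]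
  intro x hx hx'
  obtain ⟨k, rfl⟩ := Subgroup.mem_zpowers_iff.1 hx'
  rw [eq_zero_of_zpow_mem_unitsRange ϖ hϖ k hx, zpow_zero]

/-- (F2): an unramified character of `Lˣ` (trivial on the image of `Sˣ`) that is trivial on a
subgroup `F` containing the uniformiser (`F = F_v^× ∋ ϖ_v` at an inert place) is trivial. -/
theorem eq_one_of_unramified_of_le_ker (ϖ : S) (hϖ : Irreducible ϖ) (χ : Lˣ →* M)
    (hunr : (Units.map (algebraMap S L : S →* L)).range ≤ χ.ker) (F : Subgroup Lˣ)
    (hF : F ≤ χ.ker) (hϖF : uniformizerUnit ϖ hϖ ∈ F) : χ = 1 :=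
  eq_one_of_sup_zpowers_eq_top _ _ (unitsRange_sup_zpowers_eq_top ϖ hϖ) χ hunr
    (MonoidHom.mem_ker.1 (hF hϖF))

/-- (F3): two unramified characters of `Lˣ` that agree at the uniformiser are equal — for `χ`
unramified with `χ(ϖ_v) = ε_{E_v/F_v}(ϖ_v) = −1` and the unramified quadratic character `ε′_v`
(`ε′_v(ϖ_v) = −1`), this is «`χ = ε′_v`». -/
theorem eq_of_unramified_of_apply_uniformizer_eq (ϖ : S) (hϖ : Irreducible ϖ) (χ χ' : Lˣ →* M)
    (hunr : (Units.map (algebraMap S L : S →* L)).range ≤ χ.ker)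
    (hunr' : (Units.map (algebraMap S L : S →* L)).range ≤ χ'.ker)
    (h : χ (uniformizerUnit ϖ hϖ) = χ' (uniformizerUnit ϖ hϖ)) : χ = χ' :=
  eq_of_sup_zpowers_eq_top _ _ (unitsRange_sup_zpowers_eq_top ϖ hϖ) χ χ' hunr hunr' h

/-- (F3) in the form used in P7: `χ` unramified whose restriction to `F ∋ ϖ` agrees with a
character `ε` of `F`, and `ε'` unramified with `ε' ϖ = ε ϖ` ⇒ `χ = ε'`. -/
theorem eq_of_unramified_of_restrict_eq (ϖ : S) (hϖ : Irreducible ϖ) (χ ε' : Lˣ →* M)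
    (F : Subgroup Lˣ) (hϖF : uniformizerUnit ϖ hϖ ∈ F) (ε : F →* M)
    (hunr : (Units.map (algebraMap S L : S →* L)).range ≤ χ.ker)
    (hunr' : (Units.map (algebraMap S L : S →* L)).range ≤ ε'.ker)
    (hres : ∀ f : F, χ f = ε f) (hε' : ε' (uniformizerUnit ϖ hϖ) = ε ⟨_, hϖF⟩) : χ = ε' :=
  eq_of_unramified_of_apply_uniformizer_eq ϖ hϖ χ ε' hunr hunr'
    (by rw [hε']; exact hres ⟨_, hϖF⟩)

end DVR

end Summit.Ventures.HodgeRepro2.T5InertForcing
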